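import Mathlib.RingTheory.Grassmannian
import Mathlib.Algebra.Category.Ring.Basic
import HarnessLib

/-!
# The Grassmannian functor of an abelian group on the category of commutative rings

Topic `AlgebraicGeometry/Motives`; namespace `Literature.AlgebraicGeometry.Motives.Grassmannian`.
ONE DEFINITION + its two evaluation lemmas (no instance, no notation, no named fact, no `sorry`).

[GortzWedhorn2020, (8.4) pp. 213–215]: for a quasi-coherent module `ℰ` the Grassmannian functor `Grass_k(ℰ)` sends a
scheme / ring to the set of quotients of (the pullback of) `ℰ` that are locally free of rank `k`.  Mathlib has the
ring-side functor `Module.Grassmannian.functor R M k : CommAlgCat R ⥤ Type` on `R`-ALGEBRAS.  The functor-of-points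
machinery on schemes (Mathlib `Scheme.Spec : CommRingCatᵒᵖ ⥤ Scheme`, the big Zariski site, ★ `Motives.OpenSubfunctorCover`,
the comparison «Zariski sheaves on schemes = Zariski sheaves on affine schemes») is indexed by `CommRingCat`; this file
records the base-ring-`ℤ` Grassmannian functor of an abelian group `M` DIRECTLY ON `CommRingCat`:

* `grassmannianFunctor M k : CommRingCat.{u} ⥤ Type (max u v)`, `A ↦ G(k, A ⊗[ℤ] M; A)` (Mathlib `Module.Grassmannian`),
  a ring map `φ` acting by `Module.Grassmannian.map φ.toIntAlgHom` (base change of the quotient);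
* `grassmannianFunctor_obj`, `grassmannianFunctor_map` — the two defining equations (by `rfl`).

For `M = ℤⁿ` this is the functor of points of the Grassmannian `Gr(n, k)` restricted to affine schemes.  Cell `hodgecm-mathlib`
(D-0151), F-DAG first hand (h4) «Grassmannian as a scheme» (B-p21 (g15) author; B-p18 (g17) charts, B-p09 (g12) sites),
count-neutral Mathlib-side capital (brick (D1)).  Nothing here is about HC; HC_CM is proved only modulo the 7 printed citations
until rung 0 closes.

## References
* [GortzWedhorn2020] U. Görtz, T. Wedhorn, *Algebraic Geometry I*, 2nd ed. (2020), (8.4) (pp. 213–215).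
* [StacksProject] The Stacks project, Tag 089R (Grassmannians).
-/

namespace Literature.AlgebraicGeometry.Motives.Grassmannian

open CategoryTheory TensorProduct TypeCat

universe u v

variable (M : Type v) [AddCommGroup M] (k : ℕ)

/-- **The Grassmannian functor of the abelian group `M` on commutative rings**: `A ↦ G(k, A ⊗[ℤ] M; A)`, the set of
`A`-submodules `N ≤ A ⊗[ℤ] M` with `(A ⊗[ℤ] M) ⧸ N` finite projective of constant rank `k` (Mathlib `Module.Grassmannian`);
a ring map `φ : A → B` acts by base change, `Module.Grassmannian.map φ.toIntAlgHom`.  This is Mathlib's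
`Module.Grassmannian.functor ℤ M k` transported from `CommAlgCat ℤ` to `CommRingCat`.
[cite: GortzWedhorn2020, (8.4) (pp. 213–215)] [cite: StacksProject, Tag 089R] -/
noncomputable def grassmannianFunctor : CommRingCat.{u} ⥤ Type (max u v) where
  obj A := Module.Grassmannian A (A ⊗[ℤ] M) k
  map f := TypeCat.ofHom (Module.Grassmannian.map f.hom.toIntAlgHom)
  map_id A := ConcreteCategory.hom_ext _ _ fun N => Module.Grassmannian.map_id k (CommAlgCat.of ℤ A) N
  map_comp f g := ConcreteCategory.hom_ext _ _ fun N =>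
    Module.Grassmannian.map_comp k f.hom.toIntAlgHom g.hom.toIntAlgHom N

/-- The value of `grassmannianFunctor M k` at a ring `A` is `G(k, A ⊗[ℤ] M; A)`. [cite: GortzWedhorn2020, (8.4) (pp. 213–215)] -/
theorem grassmannianFunctor_obj (A : CommRingCat.{u}) :
    (grassmannianFunctor.{u, v} M k).obj A = Module.Grassmannian A (A ⊗[ℤ] M) k :=
  rfl

/-- `grassmannianFunctor M k` acts on a ring map `φ` by `Module.Grassmannian.map φ.toIntAlgHom` (base change).
[cite: GortzWedhorn2020, (8.4) (pp. 213–215)] -/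
theorem grassmannianFunctor_map {A B : CommRingCat.{u}} (φ : A ⟶ B) (N : (grassmannianFunctor.{u, v} M k).obj A) :
    (grassmannianFunctor.{u, v} M k).map φ N = Module.Grassmannian.map φ.hom.toIntAlgHom N :=
  rfl

end Literature.AlgebraicGeometry.Motives.Grassmannian
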